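import Summits.BirchSwinnertonDyer.BirchSwinnertonDyer.Theorems.ClassRecordThreeEulerHalvesAtThreeKolyImageOrderShaShiftDiv
import Summits.BirchSwinnertonDyer.BirchSwinnertonDyer.Theorems.ClassRecordThreeCornerAtThreeKolyImageOrderAtPrimeShift
import HarnessLib
/-!
# The IMAGE-KEYED Kolyvagin ORDER machine WITH GLOBAL DIVISIBILITY (D3 of the «SHIFT×DIV» merge): the bound at ONE odd
# prime from the mod-`p^M` leaves + (DIV), `#Ш(E/K)[p^∞] ≤ p^{2(M₀−t)}`, `ord_p #Ш(E/K)[p^∞] + 2t ≤ 2M₀`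
# (crux `EulerHalvesAtThree`, item stmt-BirchSwinnertonDyer-19109, road to DERIVE the r3 stub `stub_inertSavingDisplayAtThree`;
# cell `bsd-stepL`, seat `bsd-stepL-tam3-p1` g11; `--supports … --as helper`)

HONEST FRAMING: ONE THEOREM (no definition, no named fact, no `sorry`); nothing here is a BSD class theorem; no census label
moves (T7); item 19109 is NOT closed; CONDITIONAL on the displayed binders exactly as the parents. BSD is not proved by any of this.

## THIS FILE (series rationale in D1 `…KolyImageOrderBoundShiftDiv.lean`)
`card_sha_primary_le_at_of_leavesM₂Div_of_localDuality_shift_ofImage` — corner3-p2 g5's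
`card_sha_primary_le_at_of_leavesM₂_of_localDuality_shift_ofImage` (`…KolyImageOrderAtPrimeShift.lean`) VERBATIM with g9's
divisibility delta (`Theorems/ClassRecordThreeKolyvaginShaOrderAtPrimeDivisible.lean`); leaves (A)(B)(B₂) and the
annihilation ∕ `M₂` theorems are the parents' (imported, not copied).
[cite: McCallumLMS1991, §1 Theorem (Kolyvagin), §5 Lemma 5.1, Thm. 5.4, Cor. 5.6] [cite: Jetchev2008, p. 812 (1), Cor. 1.5]
[cite: GrossLMS1991, §2 Thm. 2.2 (2), §10] [cite: MilneADT2006, Ch. I §6 Prop. 6.9, Thm. 6.13(a)]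
presearch: as the parents (bookkeeping merge).
-/

noncomputable section

open scoped Classical Pointwise
set_option linter.dupNamespace false

universe u

namespace Summit.BirchSwinnertonDyer.BirchSwinnertonDyer.Theorems.ShimuraKolyvaginOfImage

open Summit.BirchSwinnertonDyer.BirchSwinnertonDyer.Theorems.ShimuraKolyvaginOrder
open WeierstrassCurve NumberField IsDedekindDomain Field Function
open Literature.NumberTheory.EllipticCurves Literature.NumberTheory.EllipticCurves.KolyvaginDescent
open Literature.NumberTheory.GaloisRepresentations
open Literature.NumberTheory.GaloisCohomology
open Literature.NumberTheory.GaloisRepresentations.DiscreteGaloisModule (mu MuCarrier)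
open Summit.BirchSwinnertonDyer.Rank1Residual.X11b Summit.BirchSwinnertonDyer.Rank1Residual.X11b.KolyvaginCT
open Summit.BirchSwinnertonDyer.BirchSwinnertonDyer.Theorems


variable (W : WeierstrassCurve ℚ) {K : Type} [Field K] [NumberField K]

/-- **Kolyvagin's bound on `Ш(E/K)[p^∞]` at one odd prime `p` REFINED BY GLOBAL DIVISIBILITY, with the four image inputs
(hIz) (hIs) (hIc) (hIt) in place of `ρ̄_{E,p}` onto, order form, from the mod-`p^M` leaves (A) + (B) + (B₂) + (DIV) at `p`
and the Cassels–Tate inputs at level `p^{M₀}`, conductor-keyed, depth `M + k`** — corner3-p2 g5's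
`card_sha_primary_le_at_of_leavesM₂_of_localDuality_shift_ofImage` VERBATIM with tam3-p1 g9's delta
(`ClassRecordThreeKolyvaginShaOrderAtPrimeDivisible`): the leaves carry one more conjunct (DIV) «`p^{M−t}·c_M(m) = 0` on
depth-`(M+k)` Kolyvagin primes», the annihilation theorems are fed the leaves without it, `t ≤ M₀` is read off at
`m = 1` (McCallum Lemma 5.1), and the last step is D2's
`card_sha_primaryComponent_le_of_localTerm_shift_ofImage_of_pow_smul_cl_eq_zero` with `hloc` from
`hloc_of_localDuality_shift`. Conclusions: `Ш(E/K)[p^∞]` finite, killed by `p^{M₀}`, `#Ш(E/K)[p^∞] ≤ p^{2(M₀−t)}`,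
`ord_p #Ш(E/K)[p^∞] + 2t ≤ 2M₀`. [cite: McCallumLMS1991, §1 Theorem (Kolyvagin), Lemma 5.1, Thm. 5.4, Cor. 5.6]
[cite: Jetchev2008, p. 812 (1) and Cor. 1.5] [cite: GrossLMS1991, §2 Thm. 2.2 (2), §10]
[cite: MilneADT2006, Ch. I §6, Prop. 6.9, Thm. 6.13(a)] -/
theorem card_sha_primary_le_at_of_leavesM₂Div_of_localDuality_shift_ofImage [W.IsElliptic]
    (hK : IsImaginaryQuadratic K) {N₀ : ℕ} [NeZero N₀] (hN : W.conductorNorm ℤ = N₀) (k : ℕ)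
    {Pt : (W.baseChange K).toAffine.Point} (hnt : ¬ IsOfFinAddOrder Pt) {p : ℕ} (hp : p.Prime) (hp2 : p ≠ 2)
    (hIz : ∃ z : Field.absoluteGaloisGroup K, ∀ t : geomTorsion (W.baseChange K) p, z • t = -t)
    (hIs : (W.baseChange K).HasIrreducibleModPGaloisRep p)
    (hIc : ∀ f : geomTorsion (W.baseChange K) p →+ geomTorsion (W.baseChange K) p,
      (∀ (g : Field.absoluteGaloisGroup K) (t : geomTorsion (W.baseChange K) p), f (g • t) = g • f t) →
        ∃ k : ℤ, ∀ t, f t = k • t)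
    (hIt : AddSubgroup.torsionBy (W.baseChange K).toAffine.Point (p : ℤ) = ⊥) (hC : Literature.NumberTheory.Automorphic.chebotarev_artinRep)
    (hW : W.exists_weilPairing p) {M₀ : ℕ} (hM₀ : 1 ≤ M₀) [NeZero (p ^ M₀)]
    {c : K ≃ₐ[ℚ] K} (hc : c ≠ 1) (hcc : c * c = 1)
    {x₀ : (W.baseChange K).toAffine.Point} (hx₀ : p ^ M₀ • x₀ = Pt)
    (hmax : ∀ Q : (W.baseChange K).toAffine.Point, p ^ (M₀ + 1) • Q ≠ Pt)
    (t : ℕ)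
    (hleaves : ∀ {M : ℕ} (_hM : 1 ≤ M)
      (hdiv : ∀ Q : geomPoints (W.baseChange K), ∃ R, ((p ^ M : ℕ) : ℤ) • R = Q)
      (c : K ≃ₐ[ℚ] K) (_hc : c ≠ 1),
      ∃ (ε : ℤ) (cl : ℕ → galH1Torsion (W.baseChange K) ((p ^ M : ℕ) : ℤ)),
        (ε = 1 ∨ ε = -1) ∧
        IsOfFinAddOrder (Affine.Point.map (W' := W) (c : K →ₐ[ℚ] K) Pt - ε • Pt) ∧
        cl 1 = kummerMapTorsion (W.baseChange K) _ hdiv Pt ∧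
        (∀ m : ℕ, Squarefree m →
          (∀ q ∈ m.primeFactors, IsKolyvaginPrime N₀ W K p q ∧ FrobEqFrobInfty W K (p ^ (M + k)) q) →
          conjAct W c _ (cl m) = (ε * (-1) ^ m.primeFactors.card) • cl m ∧
          (∀ v : HeightOneSpectrum (𝓞 K), (m : 𝓞 K) ∉ v.asIdeal →
            cl m ∈ selmerLocalKer (W.baseChange K) (v.adicCompletion K) ((p ^ M : ℕ) : ℤ)) ∧
          (∀ ℓ : ℕ, ℓ.Prime → ℓ ∣ m → ∀ v : HeightOneSpectrum (𝓞 K), (ℓ : 𝓞 K) ∈ v.asIdeal →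
            ∀ a : ℕ, (((p : ℤ) ^ a) • cl m ∈
                selmerLocalKer (W.baseChange K) (v.adicCompletion K) ((p ^ M : ℕ) : ℤ) ↔
              ((p : ℤ) ^ a) • cl (m / ℓ) ∈
                (W.baseChange K).torsionLocalKer (v.adicCompletion K) ((p ^ M : ℕ) : ℤ)))) ∧
        (∀ ℓ : ℕ, IsKolyvaginPrime N₀ W K p ℓ ∧ FrobEqFrobInfty W K (p ^ (M + k)) ℓ →
          ∀ ν : ℤ, (ν = 1 ∨ ν = -1) → ∀ d : galH1Torsion (W.baseChange K) ((p ^ M : ℕ) : ℤ),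
          conjAct W c _ d = ν • d →
          (∀ v : HeightOneSpectrum (𝓞 K), (ℓ : 𝓞 K) ∉ v.asIdeal →
            d ∈ selmerLocalKer (W.baseChange K) (v.adicCompletion K) ((p ^ M : ℕ) : ℤ)) →
          (∀ w : InfinitePlace K,
            d ∈ selmerLocalKer (W.baseChange K) w.Completion ((p ^ M : ℕ) : ℤ)) →
          ∀ s ∈ selmerGroup (W.baseChange K) ((p ^ M : ℕ) : ℤ), conjAct W c _ s = ν • s →
          ∀ a : ℕ, a < M → ∀ v : HeightOneSpectrum (𝓞 K), (ℓ : 𝓞 K) ∈ v.asIdeal →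
            ((p : ℤ) ^ a) • d ∉
              selmerLocalKer (W.baseChange K) (v.adicCompletion K) ((p ^ M : ℕ) : ℤ) →
            ((p : ℤ) ^ (M - 1 - a)) • s ∈
              (W.baseChange K).torsionLocalKer (v.adicCompletion K) ((p ^ M : ℕ) : ℤ)) ∧
        (∀ ℓ ℓ' : ℕ, IsKolyvaginPrime N₀ W K p ℓ ∧ FrobEqFrobInfty W K (p ^ (M + k)) ℓ →
          IsKolyvaginPrime N₀ W K p ℓ' ∧ FrobEqFrobInfty W K (p ^ (M + k)) ℓ' → ℓ ≠ ℓ' →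
          ∀ ν : ℤ, (ν = 1 ∨ ν = -1) → ∀ d : galH1Torsion (W.baseChange K) ((p ^ M : ℕ) : ℤ),
          conjAct W c _ d = ν • d →
          (∀ v : HeightOneSpectrum (𝓞 K), (ℓ : 𝓞 K) ∉ v.asIdeal → (ℓ' : 𝓞 K) ∉ v.asIdeal →
            d ∈ selmerLocalKer (W.baseChange K) (v.adicCompletion K) ((p ^ M : ℕ) : ℤ)) →
          (∀ w : InfinitePlace K,
            d ∈ selmerLocalKer (W.baseChange K) w.Completion ((p ^ M : ℕ) : ℤ)) →
          ∀ s ∈ selmerGroup (W.baseChange K) ((p ^ M : ℕ) : ℤ), conjAct W c _ s = ν • s →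
          (∀ v : HeightOneSpectrum (𝓞 K), (ℓ' : 𝓞 K) ∈ v.asIdeal →
            s ∈ (W.baseChange K).torsionLocalKer (v.adicCompletion K) ((p ^ M : ℕ) : ℤ)) →
          ∀ a : ℕ, a < M → ∀ v : HeightOneSpectrum (𝓞 K), (ℓ : 𝓞 K) ∈ v.asIdeal →
            ((p : ℤ) ^ a) • d ∉
              selmerLocalKer (W.baseChange K) (v.adicCompletion K) ((p ^ M : ℕ) : ℤ) →
            ((p : ℤ) ^ (M - 1 - a)) • s ∈
              (W.baseChange K).torsionLocalKer (v.adicCompletion K) ((p ^ M : ℕ) : ℤ)) ∧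
        -- GLOBAL DIVISIBILITY to depth `t` at level `p^M`: `p^{M−t} · c_M(m) = 0` (depth-`(M+k)` Kolyvagin primes)
        (∀ m : ℕ, Squarefree m →
          (∀ q ∈ m.primeFactors, IsKolyvaginPrime N₀ W K p q ∧ FrobEqFrobInfty W K (p ^ (M + k)) q) →
          ((p : ℤ) ^ (M - t)) • cl m = 0))
    (e : geomTorsion (W.baseChange K) ((p ^ M₀ * p ^ M₀ : ℕ) : ℤ) →
      geomTorsion (W.baseChange K) ((p ^ M₀ * p ^ M₀ : ℕ) : ℤ) → AlgebraicClosure K)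
    (hμ : ∀ S T, e S T ^ (p ^ M₀ * p ^ M₀) = 1)
    (hadd₁ : ∀ S₁ S₂ T, e (S₁ + S₂) T = e S₁ T * e S₂ T)
    (hadd₂ : ∀ S T₁ T₂, e S (T₁ + T₂) = e S T₁ * e S T₂)
    (hgal : ∀ (σ : absoluteGaloisGroup K) (S T : geomTorsion (W.baseChange K) ((p ^ M₀ * p ^ M₀ : ℕ) : ℤ)),
      σ • e S T = e (σ • S) (σ • T))
    (halt : ∀ T, e T T = 1) (hnondeg : ∀ T, (∀ S, e S T = 1) → T = 0)
    (inv : LocalInvariants K (p ^ M₀ * p ^ M₀)) (hPT' : inv.SumInvLocalizationEqZero)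
    (hinv : ∀ v : HeightOneSpectrum (𝓞 K), Injective (inv (Sum.inr v)))
    (hH3 : ∀ x : galoisCohomology (mu K (p ^ M₀ * p ^ M₀)) 3,
      (∀ v : Place K, galoisCohomology.localization (mu K (p ^ M₀ * p ^ M₀)) v 3 x = 0) → x = 0)
    (hB : Literature.GroupTheory.FiniteAbelian.IsLevelPairing (p ^ M₀)
      (ctLevelPairing (W.baseChange K) (p ^ M₀) e hμ hadd₁ hadd₂ hgal inv halt hPT' hH3
        (localTerm_finite_support (W := W.baseChange K) (m := p ^ M₀) (e := e) (hμ := hμ)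
          (hadd₁ := hadd₁) (hadd₂ := hadd₂) (hgal := hgal) halt inv)))
    (hPτ : ∀ z ∈ selmerGroup (W.baseChange K) ((p ^ M₀ * p ^ M₀ : ℕ) : ℤ),
      ∀ t ∈ selmerGroup (W.baseChange K) ((p ^ M₀ * p ^ M₀ : ℕ) : ℤ),
      ctGeneralFun (W.baseChange K) (p ^ M₀) e hμ hadd₁ hadd₂ hgal inv
          (torsionH1ToH1 (W.baseChange K) _ (conjAct W c _ z))
          (torsionH1ToH1 (W.baseChange K) _ (conjAct W c _ t)) =
        ctGeneralFun (W.baseChange K) (p ^ M₀) e hμ hadd₁ hadd₂ hgal inv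
          (torsionH1ToH1 (W.baseChange K) _ z) (torsionH1ToH1 (W.baseChange K) _ t)) :
    Finite (AddCommGroup.primaryComponent (W.baseChange K).sha p) ∧
    (∀ c ∈ AddCommGroup.primaryComponent (W.baseChange K).sha p, p ^ M₀ • c = 0) ∧
    Nat.card (AddCommGroup.primaryComponent (W.baseChange K).sha p) ≤ p ^ (2 * (M₀ - t)) ∧
    padicValNat p (Nat.card (AddCommGroup.primaryComponent (W.baseChange K).sha p)) + 2 * t ≤
      2 * M₀ := by
  haveI : Fact p.Prime := ⟨hp⟩
  -- the unrefined leaves (drop the divisibility conjunct), for the annihilation theorems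
  have hleaves' : ∀ {M : ℕ} (_hM : 1 ≤ M)
      (hdiv : ∀ Q : geomPoints (W.baseChange K), ∃ R, ((p ^ M : ℕ) : ℤ) • R = Q)
      (c : K ≃ₐ[ℚ] K) (_hc : c ≠ 1),
      ∃ (ε : ℤ) (cl : ℕ → galH1Torsion (W.baseChange K) ((p ^ M : ℕ) : ℤ)),
        (ε = 1 ∨ ε = -1) ∧
        IsOfFinAddOrder (Affine.Point.map (W' := W) (c : K →ₐ[ℚ] K) Pt - ε • Pt) ∧
        cl 1 = kummerMapTorsion (W.baseChange K) _ hdiv Pt ∧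
        (∀ m : ℕ, Squarefree m →
          (∀ q ∈ m.primeFactors, IsKolyvaginPrime N₀ W K p q ∧ FrobEqFrobInfty W K (p ^ (M + k)) q) →
          conjAct W c _ (cl m) = (ε * (-1) ^ m.primeFactors.card) • cl m ∧
          (∀ v : HeightOneSpectrum (𝓞 K), (m : 𝓞 K) ∉ v.asIdeal →
            cl m ∈ selmerLocalKer (W.baseChange K) (v.adicCompletion K) ((p ^ M : ℕ) : ℤ)) ∧
          (∀ ℓ : ℕ, ℓ.Prime → ℓ ∣ m → ∀ v : HeightOneSpectrum (𝓞 K), (ℓ : 𝓞 K) ∈ v.asIdeal →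
            ∀ a : ℕ, (((p : ℤ) ^ a) • cl m ∈
                selmerLocalKer (W.baseChange K) (v.adicCompletion K) ((p ^ M : ℕ) : ℤ) ↔
              ((p : ℤ) ^ a) • cl (m / ℓ) ∈
                (W.baseChange K).torsionLocalKer (v.adicCompletion K) ((p ^ M : ℕ) : ℤ)))) ∧
        (∀ ℓ : ℕ, IsKolyvaginPrime N₀ W K p ℓ ∧ FrobEqFrobInfty W K (p ^ (M + k)) ℓ →
          ∀ ν : ℤ, (ν = 1 ∨ ν = -1) → ∀ d : galH1Torsion (W.baseChange K) ((p ^ M : ℕ) : ℤ),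
          conjAct W c _ d = ν • d →
          (∀ v : HeightOneSpectrum (𝓞 K), (ℓ : 𝓞 K) ∉ v.asIdeal →
            d ∈ selmerLocalKer (W.baseChange K) (v.adicCompletion K) ((p ^ M : ℕ) : ℤ)) →
          (∀ w : InfinitePlace K,
            d ∈ selmerLocalKer (W.baseChange K) w.Completion ((p ^ M : ℕ) : ℤ)) →
          ∀ s ∈ selmerGroup (W.baseChange K) ((p ^ M : ℕ) : ℤ), conjAct W c _ s = ν • s →
          ∀ a : ℕ, a < M → ∀ v : HeightOneSpectrum (𝓞 K), (ℓ : 𝓞 K) ∈ v.asIdeal →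
            ((p : ℤ) ^ a) • d ∉
              selmerLocalKer (W.baseChange K) (v.adicCompletion K) ((p ^ M : ℕ) : ℤ) →
            ((p : ℤ) ^ (M - 1 - a)) • s ∈
              (W.baseChange K).torsionLocalKer (v.adicCompletion K) ((p ^ M : ℕ) : ℤ)) ∧
        (∀ ℓ ℓ' : ℕ, IsKolyvaginPrime N₀ W K p ℓ ∧ FrobEqFrobInfty W K (p ^ (M + k)) ℓ →
          IsKolyvaginPrime N₀ W K p ℓ' ∧ FrobEqFrobInfty W K (p ^ (M + k)) ℓ' → ℓ ≠ ℓ' →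
          ∀ ν : ℤ, (ν = 1 ∨ ν = -1) → ∀ d : galH1Torsion (W.baseChange K) ((p ^ M : ℕ) : ℤ),
          conjAct W c _ d = ν • d →
          (∀ v : HeightOneSpectrum (𝓞 K), (ℓ : 𝓞 K) ∉ v.asIdeal → (ℓ' : 𝓞 K) ∉ v.asIdeal →
            d ∈ selmerLocalKer (W.baseChange K) (v.adicCompletion K) ((p ^ M : ℕ) : ℤ)) →
          (∀ w : InfinitePlace K,
            d ∈ selmerLocalKer (W.baseChange K) w.Completion ((p ^ M : ℕ) : ℤ)) →
          ∀ s ∈ selmerGroup (W.baseChange K) ((p ^ M : ℕ) : ℤ), conjAct W c _ s = ν • s →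
          (∀ v : HeightOneSpectrum (𝓞 K), (ℓ' : 𝓞 K) ∈ v.asIdeal →
            s ∈ (W.baseChange K).torsionLocalKer (v.adicCompletion K) ((p ^ M : ℕ) : ℤ)) →
          ∀ a : ℕ, a < M → ∀ v : HeightOneSpectrum (𝓞 K), (ℓ : 𝓞 K) ∈ v.asIdeal →
            ((p : ℤ) ^ a) • d ∉
              selmerLocalKer (W.baseChange K) (v.adicCompletion K) ((p ^ M : ℕ) : ℤ) →
            ((p : ℤ) ^ (M - 1 - a)) • s ∈
              (W.baseChange K).torsionLocalKer (v.adicCompletion K) ((p ^ M : ℕ) : ℤ)) := by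
    intro M hM hdiv c hc
    obtain ⟨ε, cl, hε, h53, hc1, hcl, hdual, hdual₂, -⟩ := hleaves hM hdiv c hc
    exact ⟨ε, cl, hε, h53, hc1, hcl, hdual, hdual₂⟩
  haveI : (W.baseChange K).IsElliptic := inferInstanceAs (W.map (algebraMap ℚ K)).IsElliptic
  have hn2 : p ^ M₀ * p ^ M₀ = p ^ (2 * M₀) := by rw [two_mul, pow_add]
  -- `E(K)[p] = 0`
  have hbot := hIt
  have hA : ∀ a : (W.baseChange K).toAffine.Point, p • a = 0 → a = 0 := fun a ha ↦ by
    have : a ∈ AddSubgroup.torsionBy (W.baseChange K).toAffine.Point (p : ℤ) := by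
      rw [mem_torsionBy_iff, natCast_zsmul]; exact ha
    rw [hbot] at this
    exact this
  -- divisibility of the geometric points at every level
  have hdivj : ∀ n : ℕ, n ≠ 0 →
      ∀ Q : geomPoints (W.baseChange K), ∃ R, ((n : ℕ) : ℤ) • R = Q := fun n hn ↦
    (W.baseChange K).zsmul_geomPoints_surjective_holds (by exact_mod_cast hn)
  have hn0 : p ^ M₀ * p ^ M₀ ≠ 0 := mul_ne_zero (pow_ne_zero _ hp.ne_zero) (pow_ne_zero _ hp.ne_zero)
  have hdiv := hdivj (p ^ M₀ * p ^ M₀) hn0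
  -- the Kummer-generator facts at a level `n = p^j` (McCallum Lemma 5.1 / (4)–(6))
  have hgen : ∀ (n j : ℕ), n = p ^ j → j ≠ 0 →
      ∀ (hdiv : ∀ Q : geomPoints (W.baseChange K), ∃ R, ((n : ℕ) : ℤ) • R = Q),
      kummerMapTorsion (W.baseChange K) _ hdiv Pt =
          ((p : ℤ) ^ M₀) • kummerMapTorsion (W.baseChange K) _ hdiv x₀ ∧
        ((p : ℤ) ^ (j - 1)) • kummerMapTorsion (W.baseChange K) _ hdiv x₀ ≠ 0 := by
    rintro n j rfl hj hdiv
    refine ⟨?_, fun h ↦ ?_⟩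
    · rw [← hx₀, map_nsmul, ← natCast_zsmul]
      congr 1
    · have hker : ((p : ℤ) ^ (j - 1)) • x₀ ∈ (kummerMapTorsion (W.baseChange K) _ hdiv).ker := by
        rw [AddMonoidHom.mem_ker, map_zsmul, h]
      rw [kummerMapTorsion_ker, AddMonoidHom.mem_range] at hker
      obtain ⟨z, hz⟩ := hker
      refine pow_smul_ne_pow_sub_one_smul hA hx₀ hmax hj z ?_
      have hz' : ((p ^ j : ℕ) : ℤ) • z = ((p : ℤ) ^ (j - 1)) • x₀ := hz
      rw [← Nat.cast_pow, natCast_zsmul, natCast_zsmul] at hz'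
      exact hz'
  obtain ⟨hPx, hxord⟩ := hgen _ (2 * M₀) hn2 (by omega) hdiv
  -- the leaves, read at the level `p^{M₀}·p^{M₀}` (level-generic restatement, by `rfl`)
  obtain ⟨Φ, hΦ⟩ : ∃ Φ : ℕ → ℕ → Prop, ∀ M n : ℕ, (Φ M n ↔
          ∀ (hdiv : ∀ Q : geomPoints (W.baseChange K), ∃ R, ((n : ℕ) : ℤ) • R = Q)
          (c : K ≃ₐ[ℚ] K) (_hc : c ≠ 1),
          ∃ (ε : ℤ) (cl : ℕ → galH1Torsion (W.baseChange K) ((n : ℕ) : ℤ)),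
            (ε = 1 ∨ ε = -1) ∧
            IsOfFinAddOrder (Affine.Point.map (W' := W) (c : K →ₐ[ℚ] K) Pt - ε • Pt) ∧
            cl 1 = kummerMapTorsion (W.baseChange K) _ hdiv Pt ∧
            (∀ m : ℕ, Squarefree m →
              (∀ q ∈ m.primeFactors, IsKolyvaginPrime N₀ W K p q ∧ FrobEqFrobInfty W K (p ^ (M + k)) q) →
              conjAct W c _ (cl m) = (ε * (-1) ^ m.primeFactors.card) • cl m ∧
              (∀ v : HeightOneSpectrum (𝓞 K), (m : 𝓞 K) ∉ v.asIdeal →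
                cl m ∈ selmerLocalKer (W.baseChange K) (v.adicCompletion K) ((n : ℕ) : ℤ)) ∧
              (∀ ℓ : ℕ, ℓ.Prime → ℓ ∣ m → ∀ v : HeightOneSpectrum (𝓞 K), (ℓ : 𝓞 K) ∈ v.asIdeal →
                ∀ a : ℕ, (((p : ℤ) ^ a) • cl m ∈
                    selmerLocalKer (W.baseChange K) (v.adicCompletion K) ((n : ℕ) : ℤ) ↔
                  ((p : ℤ) ^ a) • cl (m / ℓ) ∈
                    (W.baseChange K).torsionLocalKer (v.adicCompletion K) ((n : ℕ) : ℤ)))) ∧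
            (∀ ℓ : ℕ, IsKolyvaginPrime N₀ W K p ℓ ∧ FrobEqFrobInfty W K (p ^ (M + k)) ℓ →
              ∀ ν : ℤ, (ν = 1 ∨ ν = -1) → ∀ d : galH1Torsion (W.baseChange K) ((n : ℕ) : ℤ),
              conjAct W c _ d = ν • d →
              (∀ v : HeightOneSpectrum (𝓞 K), (ℓ : 𝓞 K) ∉ v.asIdeal →
                d ∈ selmerLocalKer (W.baseChange K) (v.adicCompletion K) ((n : ℕ) : ℤ)) →
              (∀ w : InfinitePlace K,
                d ∈ selmerLocalKer (W.baseChange K) w.Completion ((n : ℕ) : ℤ)) →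
              ∀ s ∈ selmerGroup (W.baseChange K) ((n : ℕ) : ℤ), conjAct W c _ s = ν • s →
              ∀ a : ℕ, a < M → ∀ v : HeightOneSpectrum (𝓞 K), (ℓ : 𝓞 K) ∈ v.asIdeal →
                ((p : ℤ) ^ a) • d ∉
                  selmerLocalKer (W.baseChange K) (v.adicCompletion K) ((n : ℕ) : ℤ) →
                ((p : ℤ) ^ (M - 1 - a)) • s ∈
                  (W.baseChange K).torsionLocalKer (v.adicCompletion K) ((n : ℕ) : ℤ)) ∧
            (∀ ℓ ℓ' : ℕ, IsKolyvaginPrime N₀ W K p ℓ ∧ FrobEqFrobInfty W K (p ^ (M + k)) ℓ →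
              IsKolyvaginPrime N₀ W K p ℓ' ∧ FrobEqFrobInfty W K (p ^ (M + k)) ℓ' → ℓ ≠ ℓ' →
              ∀ ν : ℤ, (ν = 1 ∨ ν = -1) → ∀ d : galH1Torsion (W.baseChange K) ((n : ℕ) : ℤ),
              conjAct W c _ d = ν • d →
              (∀ v : HeightOneSpectrum (𝓞 K), (ℓ : 𝓞 K) ∉ v.asIdeal → (ℓ' : 𝓞 K) ∉ v.asIdeal →
                d ∈ selmerLocalKer (W.baseChange K) (v.adicCompletion K) ((n : ℕ) : ℤ)) →
              (∀ w : InfinitePlace K,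
                d ∈ selmerLocalKer (W.baseChange K) w.Completion ((n : ℕ) : ℤ)) →
              ∀ s ∈ selmerGroup (W.baseChange K) ((n : ℕ) : ℤ), conjAct W c _ s = ν • s →
              (∀ v : HeightOneSpectrum (𝓞 K), (ℓ' : 𝓞 K) ∈ v.asIdeal →
                s ∈ (W.baseChange K).torsionLocalKer (v.adicCompletion K) ((n : ℕ) : ℤ)) →
              ∀ a : ℕ, a < M → ∀ v : HeightOneSpectrum (𝓞 K), (ℓ : 𝓞 K) ∈ v.asIdeal →
                ((p : ℤ) ^ a) • d ∉
                  selmerLocalKer (W.baseChange K) (v.adicCompletion K) ((n : ℕ) : ℤ) →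
                ((p : ℤ) ^ (M - 1 - a)) • s ∈
                  (W.baseChange K).torsionLocalKer (v.adicCompletion K) ((n : ℕ) : ℤ)) ∧
            (∀ m : ℕ, Squarefree m →
              (∀ q ∈ m.primeFactors, IsKolyvaginPrime N₀ W K p q ∧ FrobEqFrobInfty W K (p ^ (M + k)) q) →
              ((p : ℤ) ^ (M - t)) • cl m = 0)) :=
    ⟨_, fun _ _ ↦ Iff.rfl⟩
  have hΦ1 : Φ (2 * M₀) (p ^ (2 * M₀)) :=
    (hΦ _ _).mpr fun hdiv' c' hc' ↦ hleaves (M := 2 * M₀) (by omega) hdiv' c' hc'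
  have hΦ2 : Φ (2 * M₀) (p ^ M₀ * p ^ M₀) := by rw [hn2]; exact hΦ1
  obtain ⟨ε, cl, hε, h53, hc1, hcl, hdual, -, hdivt⟩ := (hΦ _ _).mp hΦ2 hdiv c hc
  -- Kolyvagin's annihilation `p^{M₀} Ш(E/K)[p^∞] = 0` (the tree's theorem at `m = M₀`)
  have hKol := pow_smul_sha_primary_eq_zero_at_of_leavesM₂_shift_ofImage (N := N₀) W hK hnt hp hp2 hIz hIs hIc hIt (m := M₀)
    hmax hC hW k hleaves'
  have hL : ∀ a ∈ (W.baseChange K).sha,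
      (((p ^ M₀ * p ^ M₀ : ℕ) : ℤ)) • a = 0 → ((p ^ M₀ : ℕ) : ℤ) • a = 0 := by
    intro a ha h0
    have h1 : p ^ M₀ • (⟨a, ha⟩ : (W.baseChange K).sha) = 0 := by
      refine hKol ⟨a, ha⟩ ⟨2 * M₀, Subtype.ext ?_⟩
      rw [AddSubgroupClass.coe_nsmul, ZeroMemClass.coe_zero, ← hn2, ← natCast_zsmul]
      exact h0
    have h2 := congrArg Subtype.val h1
    rw [AddSubgroupClass.coe_nsmul, ZeroMemClass.coe_zero] at h2
    rw [natCast_zsmul]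
    exact h2
  -- Kolyvagin's annihilation `p^{M₀} Sel_{p^{2M₀}} ⊆ ℤ δx₀` (McCallum Prop. 2.2 at two places)
  have hkill : ∀ s ∈ selmerGroup (W.baseChange K) ((p ^ M₀ * p ^ M₀ : ℕ) : ℤ),
      ((p : ℤ) ^ M₀) • s ∈ AddSubgroup.zmultiples (kummerMapTorsion (W.baseChange K) _ hdiv x₀) := by
    have key : ∀ (n : ℕ), n = p ^ (2 * M₀) →
        ∀ (hdiv : ∀ Q : geomPoints (W.baseChange K), ∃ R, ((n : ℕ) : ℤ) • R = Q),
        ∀ s ∈ selmerGroup (W.baseChange K) ((n : ℕ) : ℤ),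
        ((p : ℤ) ^ M₀) • s ∈
          AddSubgroup.zmultiples (kummerMapTorsion (W.baseChange K) _ hdiv x₀) := by
      rintro n rfl hdiv s hs
      obtain ⟨hPx', hxord'⟩ := hgen _ (2 * M₀) rfl (by omega) hdiv
      obtain ⟨ε', cl', hε', h53', hc1', hcl', hdual', hdual₂'⟩ :=
        hleaves' (M := 2 * M₀) (by omega) hdiv c hc
      obtain ⟨S, hSel, hSx, hSp, hSM₀, -, hS₂⟩ := exists_hypothesesM₂_of_leavesM_shift_ofImage (N := N₀) W hK hp
        hp2 hIz hIs hIc hIt hC hW (M := 2 * M₀) (by omega) k hdiv hc hcc hx₀ hPx' hxord' ε' hε' h53' cl' hc1' hcl'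
        hdual' hdual₂'
      have h := S.pow_M₀_zsmul_mem_zmultiples hS₂ (s := s) (by rw [hSel]; exact hs)
      rwa [hSp, hSM₀, hSx] at h
    exact key _ hn2 hdiv
  -- the divisibility at level `p^{M₀}·p^{M₀}`, exponent `2M₀ − t`
  have hdivt' : ∀ m : ℕ, Squarefree m →
      (∀ q ∈ m.primeFactors, IsKolyvaginPrime N₀ W K p q ∧ FrobEqFrobInfty W K (p ^ (2 * M₀ + k)) q) →
      ((p : ℤ) ^ (2 * M₀ - t)) • cl m = 0 := hdivt
  -- `t ≤ M₀`: the divisibility at `m = 1` reads `p^{2M₀ − t} · p^{M₀} · δx₀ = 0`, and `ord δx₀ = p^{2M₀}`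
  -- (McCallum Lemma 5.1: `M₀ = ord_p [E(K) : ℤ y] ≥ t`)
  have ht : t ≤ M₀ := by
    by_contra hlt
    have h1 := hdivt' 1 squarefree_one (by simp)
    rw [hc1, hPx, smul_smul] at h1
    apply hxord
    obtain ⟨k', hk'⟩ := Nat.exists_eq_add_of_le (show 2 * M₀ - t + M₀ ≤ 2 * M₀ - 1 by omega)
    have hpk : ((p : ℤ) ^ (2 * M₀ - 1)) = (p : ℤ) ^ k' * ((p : ℤ) ^ (2 * M₀ - t) * (p : ℤ) ^ M₀) := by
      rw [hk']; ring
    rw [hpk, ← smul_smul, h1, zsmul_zero]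
  exact card_sha_primaryComponent_le_of_localTerm_shift_ofImage_of_pow_smul_cl_eq_zero W hK hN k hp hp2 hIz hIs hIc
    hIt hC hW hM₀ hdiv hc hcc hx₀ hPx hxord ε hε h53 cl hc1 hcl hdual e hμ hadd₁ hadd₂ hgal halt inv hPT' hH3 hB hPτ
    hkill hL (hloc_of_localDuality_shift W hK hN k hp hp2 hM₀ hc ε hε cl hcl e hμ hadd₁ hadd₂ hgal halt hnondeg inv hinv)
    t ht hdivt'

end Summit.BirchSwinnertonDyer.BirchSwinnertonDyer.Theorems.ShimuraKolyvaginOfImage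

end
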